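import Mathlib
import Summits.Ventures.HodgeRepro2.T5GaussianPlace
import Summits.Ventures.HodgeRepro2.T5EisensteinPlace
import Summits.Ventures.HodgeRepro2.T5EisensteinInertPlace
import Summits.Ventures.HodgeRepro2.T5EisensteinSplitPlace
import Summits.Ventures.HodgeRepro2.T5RamificationIndexGlobal

/-!
# THE CONCRETE PLACES IN ONE STATEMENT: `f(η_v) = 0, 1, 2` at an inert, a tame ramified and a wild ramified place,
and `L_w = K_v` at a split place (T5ConcretePlaces)

A single entry point (for the referees' non-vacuity protocol, README §10.5(ii)(c)/(d)) to the family
T5GaussianPlace / T5EisensteinPlace / T5EisensteinInertPlace / T5EisensteinSplitPlace: for each of the four kinds of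
place the route distinguishes, a place `w` of the number field above the given prime of `ℚ` EXISTS, and for EVERY
such `w` the hypothesis set of the corresponding files holds and the conductor exponent of the norm character of
`L_w/K_v` (rows 169 / 176) has the stated value — `0` at the inert place (`ℚ(ζ₃)` at `2`), `1` at the tame ramified
place (`ℚ(ζ₃)` at `3`), `2` at the wild ramified place (`ℚ(ζ₄)` at `2`) — while at the split place (`ℚ(ζ₃)` at `7`)
`[L_w : K_v] = 1`. Through T5RamificationIndexGlobal the local case split is also read as Mathlib's GLOBAL ramification
index: `e(w∣2) = 2` for `ℚ(ζ₄)`, `e(w∣3) = 2` and `e(w∣2) = 1` for `ℚ(ζ₃)`. Nothing is proved here: every clause is the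
named theorem of the files above.

No axiom beyond the standard trio; nothing of the scored record changes.
§8(d): uses an L-value-free non-vanishing device: NO.
-/

namespace Summit.Ventures.HodgeRepro2.T5ConcretePlaces

open IsDedekindDomain HeightOneSpectrum NumberField
open Summit.Ventures.HodgeRepro2

/-- THE WILD RAMIFIED PLACE `ℚ(ζ₄)/ℚ` AT `2`: a place above `2` exists, and at every such place the chain's
hypotheses hold with `f(η_v) = 2`. -/
theorem wild :
    (∃ w : HeightOneSpectrum (NumberField.RingOfIntegers T5GaussianField.L),
      w.asIdeal.LiesOver T5GaussianField.v₂.asIdeal) ∧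
    ∀ (w : HeightOneSpectrum (NumberField.RingOfIntegers T5GaussianField.L))
      [w.asIdeal.LiesOver T5GaussianField.v₂.asIdeal],
      Module.finrank (T5GaussianField.v₂.adicCompletion ℚ) (w.adicCompletion T5GaussianField.L) = 2 ∧
      Irreducible (2 : T5GaussianField.v₂.adicCompletionIntegers ℚ) ∧
      Irreducible (T5GaussianPlace.π w) ∧
      ¬ Irreducible (algebraMap (T5GaussianField.v₂.adicCompletionIntegers ℚ)
        (w.adicCompletionIntegers T5GaussianField.L) (2 : T5GaussianField.v₂.adicCompletionIntegers ℚ)) ∧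
      ∃ σ : (w.adicCompletion T5GaussianField.L) ≃ₐ[T5GaussianField.v₂.adicCompletion ℚ]
          (w.adicCompletion T5GaussianField.L), ∃ hσ : σ ≠ 1,
        T5NormCharConductor.normCharConductor T5GaussianField.v₂ w σ (2 : T5GaussianField.v₂.adicCompletionIntegers ℚ)
          (T5GaussianPlace.index_normGroup_eq_two w σ hσ) = 2 :=
  ⟨T5GaussianPlace.exists_liesOver, fun w _ =>
    ⟨T5GaussianPlace.finrank_eq_two w, T5GaussianPlace.irreducible_two, T5GaussianPlace.irreducible_pi w,
      T5GaussianPlace.not_irreducible_algebraMap_two w, by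
        obtain ⟨σ, hσ⟩ := T5GaussianPlace.exists_algEquiv_ne_one w
        exact ⟨σ, hσ, T5GaussianPlace.normCharConductor_eq_two w σ hσ _⟩⟩⟩

/-- THE TAME RAMIFIED PLACE `ℚ(ζ₃)/ℚ` AT `3`: a place above `3` exists, and at every such place the chain's hypotheses
hold, `2` is a unit of `O_{K_v}`, and `f(η_v) = 1`. -/
theorem tame :
    (∃ w : HeightOneSpectrum (NumberField.RingOfIntegers T5EisensteinField.L₃),
      w.asIdeal.LiesOver T5EisensteinField.v₃.asIdeal) ∧
    ∀ (w : HeightOneSpectrum (NumberField.RingOfIntegers T5EisensteinField.L₃))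
      [w.asIdeal.LiesOver T5EisensteinField.v₃.asIdeal],
      Module.finrank (T5EisensteinField.v₃.adicCompletion ℚ) (w.adicCompletion T5EisensteinField.L₃) = 2 ∧
      Irreducible (3 : T5EisensteinField.v₃.adicCompletionIntegers ℚ) ∧
      Irreducible (T5EisensteinPlace.π w) ∧
      ¬ Irreducible (algebraMap (T5EisensteinField.v₃.adicCompletionIntegers ℚ)
        (w.adicCompletionIntegers T5EisensteinField.L₃) (3 : T5EisensteinField.v₃.adicCompletionIntegers ℚ)) ∧
      IsUnit (2 : T5EisensteinField.v₃.adicCompletionIntegers ℚ) ∧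
      ∃ σ : (w.adicCompletion T5EisensteinField.L₃) ≃ₐ[T5EisensteinField.v₃.adicCompletion ℚ]
          (w.adicCompletion T5EisensteinField.L₃), ∃ hσ : σ ≠ 1,
        T5NormCharConductor.normCharConductor T5EisensteinField.v₃ w σ
          (3 : T5EisensteinField.v₃.adicCompletionIntegers ℚ) (T5EisensteinPlace.index_normGroup_eq_two w σ hσ) = 1 :=
  ⟨T5EisensteinPlace.exists_liesOver, fun w _ =>
    ⟨T5EisensteinPlace.finrank_eq_two w, T5EisensteinPlace.irreducible_three, T5EisensteinPlace.irreducible_pi w,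
      T5EisensteinPlace.not_irreducible_algebraMap_three w, T5EisensteinPlace.isUnit_two, by
        obtain ⟨σ, hσ⟩ := T5EisensteinPlace.exists_algEquiv_ne_one w
        exact ⟨σ, hσ, T5EisensteinPlace.normCharConductor_eq_one w σ hσ _⟩⟩⟩

/-- THE INERT PLACE `ℚ(ζ₃)/ℚ` AT `2`: a place above `2` exists, and at every such place `2` stays a uniformiser of
`O_{L_w}` and `f(η_v) = 0`. -/
theorem inert :
    (∃ w : HeightOneSpectrum (NumberField.RingOfIntegers T5EisensteinField.L₃),
      w.asIdeal.LiesOver T5GaussianField.v₂.asIdeal) ∧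
    ∀ (w : HeightOneSpectrum (NumberField.RingOfIntegers T5EisensteinField.L₃))
      [w.asIdeal.LiesOver T5GaussianField.v₂.asIdeal],
      Module.finrank (T5GaussianField.v₂.adicCompletion ℚ) (w.adicCompletion T5EisensteinField.L₃) = 2 ∧
      Irreducible (2 : T5GaussianField.v₂.adicCompletionIntegers ℚ) ∧
      Irreducible (algebraMap (T5GaussianField.v₂.adicCompletionIntegers ℚ)
        (w.adicCompletionIntegers T5EisensteinField.L₃) (2 : T5GaussianField.v₂.adicCompletionIntegers ℚ)) ∧
      ∃ σ : (w.adicCompletion T5EisensteinField.L₃) ≃ₐ[T5GaussianField.v₂.adicCompletion ℚ]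
          (w.adicCompletion T5EisensteinField.L₃), ∃ hσ : σ ≠ 1,
        T5NormCharConductor.normCharConductor T5GaussianField.v₂ w σ
          (2 : T5GaussianField.v₂.adicCompletionIntegers ℚ) (T5EisensteinInertPlace.index_normGroup_eq_two w σ hσ) = 0 :=
  ⟨T5EisensteinInertPlace.exists_liesOver, fun w _ =>
    ⟨T5EisensteinInertPlace.finrank_eq_two w, T5GaussianPlace.irreducible_two,
      T5EisensteinInertPlace.irreducible_algebraMap_two w, by
        obtain ⟨σ, hσ⟩ := T5EisensteinInertPlace.exists_algEquiv_ne_one w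
        exact ⟨σ, hσ, T5EisensteinInertPlace.normCharConductor_eq_zero w σ hσ _⟩⟩⟩

/-- THE SPLIT PLACE `ℚ(ζ₃)/ℚ` AT `7`: a place above `7` exists, and at every such place `L_w = K_v`. -/
theorem split :
    (∃ w : HeightOneSpectrum (NumberField.RingOfIntegers T5EisensteinField.L₃),
      w.asIdeal.LiesOver T5EisensteinSplitPlace.v₇.asIdeal) ∧
    ∀ (w : HeightOneSpectrum (NumberField.RingOfIntegers T5EisensteinField.L₃))
      [w.asIdeal.LiesOver T5EisensteinSplitPlace.v₇.asIdeal],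
      Module.finrank (T5EisensteinSplitPlace.v₇.adicCompletion ℚ) (w.adicCompletion T5EisensteinField.L₃) = 1 :=
  ⟨T5EisensteinSplitPlace.exists_liesOver, fun w _ => T5EisensteinSplitPlace.finrank_eq_one w⟩

/-- THE GLOBAL RAMIFICATION INDICES (Mathlib's `Ideal.ramificationIdx'`) of the three non-split places: `e(w∣2) = 2` at
`ℚ(ζ₄)`, `e(w∣3) = 2` and `e(w∣2) = 1` at `ℚ(ζ₃)` — the chain's `hram` / `Irreducible (alg ϖ)` read through
T5RamificationIndexGlobal. -/
theorem ramificationIdx' :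
    (∀ (w : HeightOneSpectrum (NumberField.RingOfIntegers T5GaussianField.L))
      [w.asIdeal.LiesOver T5GaussianField.v₂.asIdeal],
      T5GaussianField.v₂.asIdeal.ramificationIdx' w.asIdeal = 2) ∧
    (∀ (w : HeightOneSpectrum (NumberField.RingOfIntegers T5EisensteinField.L₃))
      [w.asIdeal.LiesOver T5EisensteinField.v₃.asIdeal],
      T5EisensteinField.v₃.asIdeal.ramificationIdx' w.asIdeal = 2) ∧
    (∀ (w : HeightOneSpectrum (NumberField.RingOfIntegers T5EisensteinField.L₃))
      [w.asIdeal.LiesOver T5GaussianField.v₂.asIdeal],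
      T5GaussianField.v₂.asIdeal.ramificationIdx' w.asIdeal = 1) :=
  ⟨fun w _ => (T5RamificationIndexGlobal.not_irreducible_algebraMap_iff T5GaussianField.v₂ w
      T5GaussianField.finrank_eq_two T5GaussianPlace.irreducible_two).mp
      (T5GaussianPlace.not_irreducible_algebraMap_two w),
    fun w _ => (T5RamificationIndexGlobal.not_irreducible_algebraMap_iff T5EisensteinField.v₃ w
      T5EisensteinField.finrank_eq_two T5EisensteinPlace.irreducible_three).mp
      (T5EisensteinPlace.not_irreducible_algebraMap_three w),
    fun w _ => (T5RamificationIndexGlobal.irreducible_algebraMap_iff T5GaussianField.v₂ w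
      T5GaussianPlace.irreducible_two).mp (T5EisensteinInertPlace.irreducible_algebraMap_two w)⟩

end Summit.Ventures.HodgeRepro2.T5ConcretePlaces
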